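import Mathlib.MeasureTheory.Constructions.Pi
import Mathlib.MeasureTheory.Group.Measure
import Mathlib.Algebra.MvPolynomial.Equiv
import Mathlib.Algebra.Polynomial.Roots
import HarnessLib

/-!
# Two Fubini null-set criteria: the zero set of a non-zero polynomial is null for a product of atomless measures,
# and a set all of whose «sheared» fibres are null is Haar-null

Topic `MeasureTheory/Constructions`; namespace `Literature.MeasureTheory.Constructions`.  THEOREMS ONLY (no definition, no instance, no
notation, no named fact, no `sorry`); Mathlib-only imports.

* §1 (private) `measurable_mvPolynomial_eval` — evaluation of a multivariate polynomial at a measurable family of coordinates is measurable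
  (measurable ring operations).
* §2 **`pi_zeroLocus_mvPolynomial_eq_zero`** — for an integral domain `K` with measurable ring operations, a measurable INJECTIVE
  coordinate `e : X → K` and an ATOMLESS σ-finite measure `μ` on `X`: the zero set `{x : Fin n → X | P(e ∘ x) = 0}` of a NON-ZERO
  `P ∈ K[X₁, …, X_n]` is null for the product measure `μ^{⊗ n}` (induction on `n` through Mathlib's `MvPolynomial.finSuccEquiv` ∕
  `measurePreserving_piFinSuccAbove`: almost every section is the root set of a non-zero one-variable polynomial, which is finite,
  hence null for an atomless measure) — the induction of [CaronTraynor2005] verbatim, for a general atomless product measure.  The tree's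
  ★ `Literature/MeasureTheory/Lebesgue/PolynomialZeroSet` (`MvPolynomial.volume_zeroSet_eq_zero`: `X = K = ℝ`, `e = id`, Lebesgue measure) and
  ★ `…/TrigonometricPolynomialZeroSet` (`K = ℂ`, `X = ℝ`, `e = e^{i·}` up to countable fibres) are the special cases already held; the form with an
  injective coordinate `e` and an ARBITRARY atomless measure serves compact tori `U(1) ⊂ K` of a local field (no Lebesgue measure there).
* §3 **`measure_eq_zero_of_forall_shear_null`** — for a left-invariant s-finite measure `ν` on a measurable group `G`, any s-finite
  measure `μ ≠ 0` on a parameter space `T` and any measurable `ι : T → G`: if for EVERY `g ∈ G` the fibre `{t | ι t · g ∈ S}` is `μ`-null,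
  then the measurable set `S` is `ν`-null (Tonelli both ways on `{(t, g) | ι t · g ∈ S}`: `μ(T) · ν(S) = ∫ μ{t | ι t · g ∈ S} dν(g) = 0`).
  This is the device by which «the singular set of a `p`-adic reductive group is Haar-null» is reduced to polynomial algebra along a
  torus (consumer: the `hodgecm-mathlib` cell, crux H413, line LH6 «StCharTS», brick (J8)).

## References
* [CaronTraynor2005] R. Caron, T. Traynor, *The zero set of a polynomial*, WSMR Report 05-02, Univ. of Windsor (2005), Theorem p. 1.
* [Folland1999] G. B. Folland, *Real Analysis*, 2nd ed. (1999), §2.5 Thm. 2.37 (Fubini–Tonelli).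
* [HarishChandra1970] Harish-Chandra (notes by G. van Dijk), *Harmonic Analysis on Reductive p-adic Groups*, LNM 162 (1970), Lemma 42
  (the application: singular sets are null).
-/

set_option autoImplicit false

noncomputable section

open _root_.MeasureTheory _root_.MeasureTheory.Measure Set Function

namespace Literature.MeasureTheory.Constructions

/-! ## §1 Measurability of polynomial evaluation -/

section Measurable

variable {K : Type*} [CommSemiring K] [MeasurableSpace K] [MeasurableAdd₂ K] [MeasurableMul₂ K]
  {σ : Type*} {X : Type*} [MeasurableSpace X] {e : X → K}

/-- **Evaluation of a multivariate polynomial at measurable coordinates is measurable**: if `e : X → K` is measurable and `K` has measurable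
ring operations, then `x ↦ P(e(x_1), …, e(x_n))` is measurable on `σ → X` (induction on `P`). [folklore] -/
private theorem measurable_mvPolynomial_eval (he : Measurable e) (P : MvPolynomial σ K) :
    Measurable fun x : σ → X => MvPolynomial.eval (fun i => e (x i)) P := by
  induction P using MvPolynomial.induction_on with
  | C a =>
    simp only [MvPolynomial.eval_C]
    exact measurable_const
  | add p q hp hq =>
    simp only [map_add]
    exact hp.add hq
  | mul_X p i hp =>
    simp only [map_mul, MvPolynomial.eval_X]
    exact hp.mul (he.comp (measurable_pi_apply i))

end Measurable

/-! ## §2 The zero set of a non-zero polynomial is null for a product of atomless measures -/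

section FinZero

variable {K : Type*} [CommSemiring K] {X : Type*} {e : X → K}

/-- In ZERO variables a non-zero polynomial is a non-zero constant: its zero set is empty. [folklore] -/
private theorem zeroLocus_mvPolynomial_fin_zero_eq_empty (P : MvPolynomial (Fin 0) K) (hP : P ≠ 0) :
    {x : Fin 0 → X | MvPolynomial.eval (fun i => e (x i)) P = 0} = ∅ := by
  have hc : P = MvPolynomial.C (P.coeff 0) := MvPolynomial.eq_C_of_isEmpty P
  have h0 : P.coeff 0 ≠ 0 := fun h => hP (by rw [hc, h, map_zero])
  ext x
  simp only [mem_setOf_eq, mem_empty_iff_false, iff_false]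
  have hev : MvPolynomial.eval (fun i => e (x i)) P = P.coeff 0 := by
    conv_lhs => rw [hc]
    rw [MvPolynomial.eval_C]
  rw [hev]
  exact h0

end FinZero

section ZeroLocus

variable {K : Type*} [CommRing K] [IsDomain K] [MeasurableSpace K] [MeasurableSingletonClass K] [MeasurableAdd₂ K] [MeasurableMul₂ K]
  {X : Type*} [MeasurableSpace X] {e : X → K}

omit [MeasurableSpace K] [MeasurableSingletonClass K] [MeasurableAdd₂ K] [MeasurableMul₂ K] in
/-- The one-variable step: the set of `x ∈ X` at which a NON-ZERO polynomial `q ∈ K[Y]` vanishes at `e x` is finite (finitely many roots in the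
domain `K`, injective `e`), hence null for an atomless measure. [folklore] -/
private theorem measure_setOf_eval_eq_zero_of_ne_zero (hinj : Injective e) (μ : Measure X) [NullSingletonClass μ] (q : Polynomial K) (hq : q ≠ 0) :
    μ {x : X | q.eval (e x) = 0} = 0 := by
  have hfin : ({x : X | q.eval (e x) = 0}).Finite := by
    have h1 : {x : X | q.eval (e x) = 0} = e ⁻¹' {r : K | q.IsRoot r} := rfl
    rw [h1]
    exact (Polynomial.finite_setOf_isRoot hq).preimage hinj.injOn
  exact hfin.measure_zero μ

/-- **The zero set of a non-zero polynomial is null for a product of atomless measures.**  Let `K` be an integral domain with measurable ring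
operations, `e : X → K` measurable and injective, `μ` an atomless σ-finite measure on `X`.  For every `n` and every NON-ZERO
`P ∈ K[X_0, …, X_{n-1}]`, `μ^{⊗ n} {x : Fin n → X | P(e(x_0), …, e(x_{n-1})) = 0} = 0`.  (Induction on `n`: write `P` as a polynomial `Q` in the
first variable with coefficients in the others; off the null zero set of a non-zero coefficient of `Q` the section is the root set of a non-zero
one-variable polynomial — finite, hence `μ`-null — and Tonelli concludes.)  The cited statement is the case `X = K = ℝ`, Lebesgue measure; the proof is its induction.
[cite: CaronTraynor2005, Theorem (p. 1)] [cite: Folland1999, §2.5 Thm. 2.37] -/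
theorem pi_zeroLocus_mvPolynomial_eq_zero (he : Measurable e) (hinj : Injective e) (μ : Measure X) [SigmaFinite μ] [NullSingletonClass μ] :
    ∀ (n : ℕ) (P : MvPolynomial (Fin n) K), P ≠ 0 →
      Measure.pi (fun _ : Fin n => μ) {x : Fin n → X | MvPolynomial.eval (fun i => e (x i)) P = 0} = 0 := by
  intro n
  induction n with
  | zero =>
    intro P hP
    rw [zeroLocus_mvPolynomial_fin_zero_eq_empty P hP, measure_empty]
  | succ n ih =>
    intro P hP
    -- `P` as a one-variable polynomial `Q` over the remaining variables; a non-zero coefficient `Q.coeff k`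
    set Q : Polynomial (MvPolynomial (Fin n) K) := MvPolynomial.finSuccEquiv K n P with hQdef
    have hQ0 : Q ≠ 0 := fun h => hP ((MvPolynomial.finSuccEquiv K n).injective (by rw [← hQdef, h, map_zero]))
    set k : ℕ := Q.natDegree with hkdef
    have hk : Q.coeff k ≠ 0 := Polynomial.leadingCoeff_ne_zero.mpr hQ0
    -- the bad set of the remaining variables is null (induction hypothesis)
    have hB : Measure.pi (fun _ : Fin n => μ) {y : Fin n → X | MvPolynomial.eval (fun i => e (y i)) (Q.coeff k) = 0} = 0 := ih _ hk
    -- split off the first coordinate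
    set φ := MeasurableEquiv.piFinSuccAbove (fun _ : Fin (n + 1) => X) 0 with hφdef
    have hφ : MeasurePreserving φ (Measure.pi fun _ : Fin (n + 1) => μ) (μ.prod (Measure.pi fun _ : Fin n => μ)) :=
      measurePreserving_piFinSuccAbove (fun _ : Fin (n + 1) => μ) 0
    set Z : Set (Fin (n + 1) → X) := {x | MvPolynomial.eval (fun i => e (x i)) P = 0} with hZdef
    have hZm : MeasurableSet Z := measurable_mvPolynomial_eval he P (measurableSet_singleton 0)
    have hZeq : Z = φ ⁻¹' (φ.symm ⁻¹' Z) := by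
      rw [← Set.preimage_comp, MeasurableEquiv.symm_comp_self, Set.preimage_id]
    rw [hZeq, hφ.measure_preimage_equiv (φ.symm ⁻¹' Z), Measure.prod_apply_symm (φ.symm.measurable hZm)]
    refine (lintegral_congr_ae ?_).trans lintegral_zero
    have hae : ∀ᵐ y ∂(Measure.pi fun _ : Fin n => μ), MvPolynomial.eval (fun i => e (y i)) (Q.coeff k) ≠ 0 := by
      rw [ae_iff]
      simpa only [not_not] using hB
    filter_upwards [hae] with y hy
    -- the section at `y` is the root set of the non-zero one-variable polynomial `Q_y`
    set Qy : Polynomial K := Q.map (MvPolynomial.eval fun i => e (y i)) with hQydef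
    have hQy : Qy ≠ 0 := by
      intro h
      apply hy
      have := congrArg (fun q : Polynomial K => q.coeff k) h
      simpa only [hQydef, Polynomial.coeff_map, Polynomial.coeff_zero] using this
    have hpt : ∀ x₀ : X, (fun i => e (φ.symm (x₀, y) i)) = Fin.cons (e x₀) (fun i => e (y i)) := by
      intro x₀
      funext i
      refine Fin.cases ?_ (fun j => ?_) i
      · simp [hφdef]
      · simp [hφdef]
    have hsub : (fun x₀ : X => (x₀, y)) ⁻¹' (φ.symm ⁻¹' Z) ⊆ {x₀ : X | Qy.eval (e x₀) = 0} := by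
      intro x₀ hx₀
      simp only [mem_preimage, hZdef, mem_setOf_eq] at hx₀
      rw [hpt x₀, MvPolynomial.eval_eq_eval_mv_eval'] at hx₀
      exact hx₀
    exact measure_mono_null hsub (measure_setOf_eval_eq_zero_of_ne_zero hinj μ Qy hQy)

/-- The same for several atomless measures `μ_i` (one per variable). [cite: CaronTraynor2005, Theorem (p. 1)] -/
theorem pi_zeroLocus_mvPolynomial_eq_zero' (he : Measurable e) (hinj : Injective e) {n : ℕ} (μ : Fin n → Measure X)
    [∀ i, SigmaFinite (μ i)] [∀ i, NullSingletonClass (μ i)] (P : MvPolynomial (Fin n) K) (hP : P ≠ 0) :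
    Measure.pi μ {x : Fin n → X | MvPolynomial.eval (fun i => e (x i)) P = 0} = 0 := by
  revert μ P
  induction n with
  | zero =>
    intro μ _ _ P hP
    rw [zeroLocus_mvPolynomial_fin_zero_eq_empty P hP, measure_empty]
  | succ n ih =>
    intro μ _ _ P hP
    set Q : Polynomial (MvPolynomial (Fin n) K) := MvPolynomial.finSuccEquiv K n P with hQdef
    have hQ0 : Q ≠ 0 := fun h => hP ((MvPolynomial.finSuccEquiv K n).injective (by rw [← hQdef, h, map_zero]))
    set k : ℕ := Q.natDegree with hkdef
    have hk : Q.coeff k ≠ 0 := Polynomial.leadingCoeff_ne_zero.mpr hQ0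
    have hB : Measure.pi (fun j : Fin n => μ (Fin.succ j)) {y : Fin n → X | MvPolynomial.eval (fun i => e (y i)) (Q.coeff k) = 0} = 0 :=
      ih (fun j => μ (Fin.succ j)) _ hk
    set φ := MeasurableEquiv.piFinSuccAbove (fun _ : Fin (n + 1) => X) 0 with hφdef
    have hφ : MeasurePreserving φ (Measure.pi μ) ((μ 0).prod (Measure.pi fun j : Fin n => μ (Fin.succ j))) := by
      simpa only [Fin.succAbove_zero] using measurePreserving_piFinSuccAbove μ 0
    set Z : Set (Fin (n + 1) → X) := {x | MvPolynomial.eval (fun i => e (x i)) P = 0} with hZdef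
    have hZm : MeasurableSet Z := measurable_mvPolynomial_eval he P (measurableSet_singleton 0)
    have hZeq : Z = φ ⁻¹' (φ.symm ⁻¹' Z) := by
      rw [← Set.preimage_comp, MeasurableEquiv.symm_comp_self, Set.preimage_id]
    rw [hZeq, hφ.measure_preimage_equiv (φ.symm ⁻¹' Z), Measure.prod_apply_symm (φ.symm.measurable hZm)]
    refine (lintegral_congr_ae ?_).trans lintegral_zero
    have hae : ∀ᵐ y ∂(Measure.pi fun j : Fin n => μ (Fin.succ j)), MvPolynomial.eval (fun i => e (y i)) (Q.coeff k) ≠ 0 := by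
      rw [ae_iff]
      simpa only [not_not] using hB
    filter_upwards [hae] with y hy
    set Qy : Polynomial K := Q.map (MvPolynomial.eval fun i => e (y i)) with hQydef
    have hQy : Qy ≠ 0 := by
      intro h
      apply hy
      have := congrArg (fun q : Polynomial K => q.coeff k) h
      simpa only [hQydef, Polynomial.coeff_map, Polynomial.coeff_zero] using this
    have hpt : ∀ x₀ : X, (fun i => e (φ.symm (x₀, y) i)) = Fin.cons (e x₀) (fun i => e (y i)) := by
      intro x₀
      funext i
      refine Fin.cases ?_ (fun j => ?_) i
      · simp [hφdef]
      · simp [hφdef]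
    have hsub : (fun x₀ : X => (x₀, y)) ⁻¹' (φ.symm ⁻¹' Z) ⊆ {x₀ : X | Qy.eval (e x₀) = 0} := by
      intro x₀ hx₀
      simp only [mem_preimage, hZdef, mem_setOf_eq] at hx₀
      rw [hpt x₀, MvPolynomial.eval_eq_eval_mv_eval'] at hx₀
      exact hx₀
    exact measure_mono_null hsub (measure_setOf_eval_eq_zero_of_ne_zero hinj (μ 0) Qy hQy)

end ZeroLocus

/-! ## §3 The shear criterion: a set all of whose translated fibres along a parametrised family are null is null -/

section Shear

variable {G : Type*} [Group G] [MeasurableSpace G] [MeasurableMul₂ G] {T : Type*} [MeasurableSpace T]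

/-- **Shear criterion for null sets of a left-invariant measure.**  `ν` a left-invariant s-finite measure on a measurable group `G`, `μ ≠ 0` an s-finite
measure on `T`, `ι : T → G` measurable, `S ⊆ G` measurable.  If for EVERY `g ∈ G` the set of parameters `t` with `ι t · g ∈ S` is `μ`-null, then
`ν S = 0`.  (Tonelli on `A = {(t, g) | ι t · g ∈ S}`: integrating first in `g`, each slice is a left translate of `S`, so `(μ ⊗ ν)(A) = μ(T)·ν(S)`;
integrating first in `t`, every slice is null — the Fubini–Tonelli theorem for the s-finite product `μ ⊗ ν`.) [cite: Folland1999, §2.5 Thm. 2.37] -/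
theorem measure_eq_zero_of_forall_shear_null (ν : Measure G) [SFinite ν] [ν.IsMulLeftInvariant] (μ : Measure T) [SFinite μ]
    (hμ : μ ≠ 0) {ι : T → G} (hι : Measurable ι) {S : Set G} (hS : MeasurableSet S)
    (h : ∀ g : G, μ {t : T | ι t * g ∈ S} = 0) : ν S = 0 := by
  set A : Set (T × G) := {p | ι p.1 * p.2 ∈ S} with hAdef
  have hAm : MeasurableSet A := ((hι.comp measurable_fst).mul measurable_snd) hS
  have h1 : μ.prod ν A = μ univ * ν S := by
    rw [Measure.prod_apply hAm]
    have hslice : ∀ t : T, ν (Prod.mk t ⁻¹' A) = ν S := fun t => by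
      have : Prod.mk t ⁻¹' A = (fun g => ι t * g) ⁻¹' S := rfl
      rw [this, measure_preimage_mul]
    simp_rw [hslice]
    rw [lintegral_const, mul_comm]
  have h2 : μ.prod ν A = 0 := by
    rw [Measure.prod_apply_symm hAm]
    have hslice : ∀ g : G, μ ((fun t => (t, g)) ⁻¹' A) = 0 := fun g => h g
    simp_rw [hslice]
    exact lintegral_zero
  rw [h1] at h2
  rcases mul_eq_zero.mp h2 with h0 | h0
  · exact absurd (Measure.measure_univ_eq_zero.mp h0) hμ
  · exact h0

/-- Right-translation form for a RIGHT-invariant measure: if every fibre `{t | g · ι t ∈ S}` is `μ`-null then `ν S = 0`. [cite: Folland1999, §2.5 Thm. 2.37] -/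
theorem measure_eq_zero_of_forall_shear_null_right (ν : Measure G) [SFinite ν] [ν.IsMulRightInvariant] (μ : Measure T) [SFinite μ]
    (hμ : μ ≠ 0) {ι : T → G} (hι : Measurable ι) {S : Set G} (hS : MeasurableSet S)
    (h : ∀ g : G, μ {t : T | g * ι t ∈ S} = 0) : ν S = 0 := by
  set A : Set (T × G) := {p | p.2 * ι p.1 ∈ S} with hAdef
  have hAm : MeasurableSet A := (measurable_snd.mul (hι.comp measurable_fst)) hS
  have h1 : μ.prod ν A = μ univ * ν S := by
    rw [Measure.prod_apply hAm]
    have hslice : ∀ t : T, ν (Prod.mk t ⁻¹' A) = ν S := fun t => by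
      have : Prod.mk t ⁻¹' A = (fun g => g * ι t) ⁻¹' S := rfl
      rw [this, measure_preimage_mul_right]
    simp_rw [hslice]
    rw [lintegral_const, mul_comm]
  have h2 : μ.prod ν A = 0 := by
    rw [Measure.prod_apply_symm hAm]
    have hslice : ∀ g : G, μ ((fun t => (t, g)) ⁻¹' A) = 0 := fun g => h g
    simp_rw [hslice]
    exact lintegral_zero
  rw [h1] at h2
  rcases mul_eq_zero.mp h2 with h0 | h0
  · exact absurd (Measure.measure_univ_eq_zero.mp h0) hμ
  · exact h0

end Shear

end Literature.MeasureTheory.Constructions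

end
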